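import Mathlib.LinearAlgebra.Matrix.Transvection
import Mathlib.LinearAlgebra.Matrix.Block
import Literature.NumberTheory.Automorphic.HarishChandraGLProofs
import Literature.NumberTheory.Automorphic.HarishChandraGLParameterOfCharacter
import HarnessLib

/-!
# The adjoint group acts trivially on the centre of `U(𝔤𝔩ₙ(𝕜))`
(inner automorphisms of `𝔤𝔩ₙ(𝕜)`, `𝕜 = ℝ, ℂ`, fix `Z(𝔤)` pointwise; theorems only)

Topic `NumberTheory/Automorphic`; a proof file next to `HarishChandraGL`, `HarishChandraGLProofs`,
`HarishChandraGLIsomorphism`, `HarishChandraGLParameterOfCharacter`. `𝔤 = 𝔤𝔩ₙ(𝕜)` as a real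
Lie algebra, `U(𝔤)` its real enveloping algebra, `Z(𝔤)` the centre. For `M ∈ GL_n(𝕜)` the inner
automorphism `Ad(M) : X ↦ M X M⁻¹` of `𝔤` induces an automorphism `U(Ad M)` of `U(𝔤)`
preserving `Z(𝔤)`. **Main result** (`lift_ι_comp_conj_eq`): `U(Ad M) z = z` for every
`z ∈ Z(𝔤)` and every invertible `M` — for a connected group this is the standard fact that the
adjoint group acts trivially on `Z(𝔤) = U(𝔤)^𝔤` (Dixmier, *Enveloping Algebras*, 2.4.17 with
2.2.18); `GL_n(ℝ)` is disconnected, and the proof given here is algebraic: by the highest weight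
characterisation of the Harish-Chandra homomorphism `γ` (tree: `HarishChandraHomGL`, existence
`harishChandraHomGL`, injectivity `HarishChandraHomGL.baseChange_injective_and_range_eq`) and the
Zariski-dense family of highest weight vectors of the polynomial model
(`isHighestWeightVector_hwPoly`, `eq_zero_of_forall_aeval_hwWeight` of `HarishChandraGLProofs`):

* for `b` upper triangular, `Ad(b)` preserves `𝔫` and acts trivially on `𝔥` modulo `𝔫`, so it
  preserves highest weight vectors and their weights (`IsHighestWeightVector.comp_conj_upper`);
  comparing the actions of `z` and `U(Ad b) z` on the highest weight vectors `f_c` gives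
  `γ(U(Ad b) z) = γ(z)`, hence `U(Ad b) z = z` (`lift_ι_comp_conj_eq_of_upper`; `γ` is injective
  on `Z(𝔤)`, `HarishChandraHomGL.toAlgHom_injective`);
* for `L` lower triangular, `Ad(L) = θ ∘ Ad((Lᵀ)⁻¹) ∘ θ⁻¹` for the automorphism `θ(X) = -Xᵀ`
  (`lift_ι_comp_conj_eq_of_lower`);
* `GL_n(𝕜)` is generated by diagonal matrices and transvections, each upper or lower triangular
  (Mathlib `Matrix.diagonal_transvection_induction_of_det_ne_zero`).

Consequence used for automorphic representations (`lift_comp_conj_eq_lift`): **twisting a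
representation `ρ` of `𝔤𝔩ₙ(𝕜)` by an inner automorphism does not change the action of `Z(𝔤)`**,
`lift (ρ ∘ Ad M) z = lift ρ z` — the input for the `K_∞`-equivariance of the action of the centre
(Schur's lemma for `(𝔤, K_∞) × G(𝔸_f)`-modules with disconnected `K_∞`).

Also: functoriality of `U` (`lift_ι_comp_comp`, `lift_ι_comp_id`, `lift_ι_comp_mem_center`),
the inner automorphisms as real Lie algebra maps (`exists_lieHom_conj`, an existence statement).

## References

* J. Dixmier, *Enveloping Algebras* (1977/1996), 2.2.18, 2.4.17.
* A. W. Knapp, *Lie Groups Beyond an Introduction*, 2nd ed. (2002), §V.5, Thm. 5.44. [Knapp2002]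
* A. W. Knapp, D. A. Vogan, *Cohomological Induction and Unitary Representations* (1995), §IV.8,
  Prop. 4.117 ff. (`Ad(k) z = z` in the Harish-Chandra class). [KnappVogan1995]
-/

-- Mathlib idiom (Mathlib/Algebra/Lie/OfAssociative.lean): the commutator bracket on associative rings;
-- needed to state `𝔤𝔩ₙ(𝕜) →ₗ⁅ℝ⁆ End V` (as in `HarishChandraGL`)
attribute [local instance 100] LieRing.ofAssociativeRing

open scoped TensorProduct Matrix

noncomputable section

namespace Literature.NumberTheory.Automorphic

/-! ### Functoriality of the enveloping algebra -/

section Functoriality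

variable {L₁ L₂ L₃ : Type*} [LieRing L₁] [LieAlgebra ℝ L₁] [LieRing L₂] [LieAlgebra ℝ L₂]
  [LieRing L₃] [LieAlgebra ℝ L₃]

/-- `U(g ∘ f) = U(g) ∘ U(f)` for Lie algebra maps (`U(f) = lift (ι ∘ f)`). Dixmier 2.1.
[folklore] -/
theorem lift_ι_comp_comp (f : L₁ →ₗ⁅ℝ⁆ L₂) (g : L₂ →ₗ⁅ℝ⁆ L₃) (u : UniversalEnvelopingAlgebra ℝ L₁) :
    UniversalEnvelopingAlgebra.lift ℝ ((UniversalEnvelopingAlgebra.ι ℝ).comp (g.comp f)) u =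
      UniversalEnvelopingAlgebra.lift ℝ ((UniversalEnvelopingAlgebra.ι ℝ).comp g)
        (UniversalEnvelopingAlgebra.lift ℝ ((UniversalEnvelopingAlgebra.ι ℝ).comp f) u) :=
  UniversalEnvelopingAlgebra.lift_comp_apply f ((UniversalEnvelopingAlgebra.ι ℝ).comp g) u

/-- `U(id) = id`. [folklore] -/
theorem lift_ι_comp_id (u : UniversalEnvelopingAlgebra ℝ L₁) :
    UniversalEnvelopingAlgebra.lift ℝ
      ((UniversalEnvelopingAlgebra.ι ℝ).comp (LieHom.id : L₁ →ₗ⁅ℝ⁆ L₁)) u = u := by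
  have h : ((AlgHom.id ℝ (UniversalEnvelopingAlgebra ℝ L₁) :
      UniversalEnvelopingAlgebra ℝ L₁ → UniversalEnvelopingAlgebra ℝ L₁)) ∘
        UniversalEnvelopingAlgebra.ι ℝ =
      (UniversalEnvelopingAlgebra.ι ℝ).comp (LieHom.id : L₁ →ₗ⁅ℝ⁆ L₁) := rfl
  rw [← (UniversalEnvelopingAlgebra.lift_unique ℝ _ _).mp h]
  rfl

/-- `U` of a Lie algebra isomorphism maps the centre into the centre. [folklore] -/
theorem lift_ι_comp_mem_center (e : L₁ ≃ₗ⁅ℝ⁆ L₂) {z : UniversalEnvelopingAlgebra ℝ L₁}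
    (hz : z ∈ Subalgebra.center ℝ (UniversalEnvelopingAlgebra ℝ L₁)) :
    UniversalEnvelopingAlgebra.lift ℝ ((UniversalEnvelopingAlgebra.ι ℝ).comp e.toLieHom) z ∈
      Subalgebra.center ℝ (UniversalEnvelopingAlgebra ℝ L₂) := by
  rw [Subalgebra.mem_center_iff] at hz ⊢
  intro b
  have hid : e.toLieHom.comp e.symm.toLieHom = LieHom.id := LieHom.ext fun x => e.apply_symm_apply x
  have hb : b = UniversalEnvelopingAlgebra.lift ℝ ((UniversalEnvelopingAlgebra.ι ℝ).comp e.toLieHom)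
      (UniversalEnvelopingAlgebra.lift ℝ ((UniversalEnvelopingAlgebra.ι ℝ).comp e.symm.toLieHom) b) := by
    rw [← lift_ι_comp_comp, hid, lift_ι_comp_id]
  rw [hb, ← map_mul, ← map_mul, hz]

end Functoriality

/-! ### Inner automorphisms of `𝔤𝔩ₙ(𝕜)` and highest weight vectors -/

section GLn

variable {𝕜 : Type*} [RCLike 𝕜] {n : ℕ}

/-- **The inner automorphism `Ad(M) : X ↦ M X M⁻¹` of `𝔤𝔩ₙ(𝕜)`** (`M` invertible) as a real Lie
algebra map, which is bijective (an existence statement; Mathlib's `Matrix.lieConj` is the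
`𝕜`-linear version). Knapp 2002, I.§10, (1.83). [folklore] -/
theorem exists_lieHom_conj (M : Matrix (Fin n) (Fin n) 𝕜) (hM : IsUnit M.det) :
    ∃ e : Matrix (Fin n) (Fin n) 𝕜 →ₗ⁅ℝ⁆ Matrix (Fin n) (Fin n) 𝕜,
      (∀ X, e X = M * X * M⁻¹) ∧ Function.Bijective e := by
  refine ⟨{ toFun := fun X => M * X * M⁻¹
            map_add' := fun X Y => by rw [Matrix.mul_add, Matrix.add_mul]
            map_smul' := fun c X => by rw [Matrix.mul_smul, Matrix.smul_mul, RingHom.id_apply]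
            map_lie' := fun {X Y} => ?_ }, fun X => rfl, ?_⟩
  · simp only [LieRing.of_associative_ring_bracket, Matrix.mul_sub, Matrix.sub_mul]
    congr 1
    · rw [Matrix.mul_assoc (M * X), ← Matrix.mul_assoc M⁻¹, ← Matrix.mul_assoc M⁻¹,
        Matrix.nonsing_inv_mul _ hM, Matrix.one_mul, Matrix.mul_assoc M, Matrix.mul_assoc M,
        Matrix.mul_assoc X]
    · rw [Matrix.mul_assoc (M * Y), ← Matrix.mul_assoc M⁻¹, ← Matrix.mul_assoc M⁻¹,
        Matrix.nonsing_inv_mul _ hM, Matrix.one_mul, Matrix.mul_assoc M, Matrix.mul_assoc M,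
        Matrix.mul_assoc Y]
  · refine Function.bijective_iff_has_inverse.mpr ⟨fun X => M⁻¹ * X * M, fun X => ?_, fun X => ?_⟩
    · show M⁻¹ * (M * X * M⁻¹) * M = X
      rw [Matrix.mul_assoc, Matrix.mul_assoc, Matrix.nonsing_inv_mul _ hM, Matrix.mul_one,
        ← Matrix.mul_assoc, Matrix.nonsing_inv_mul _ hM, Matrix.one_mul]
    · show M * (M⁻¹ * X * M) * M⁻¹ = X
      rw [Matrix.mul_assoc, Matrix.mul_assoc, Matrix.mul_nonsing_inv _ hM, Matrix.mul_one,
        ← Matrix.mul_assoc, Matrix.mul_nonsing_inv _ hM, Matrix.one_mul]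

/-- For `b` upper triangular invertible and `X` strictly upper triangular, `b X b⁻¹` is strictly
upper triangular. [folklore] -/
theorem conj_mem_upperNilpLie {b : Matrix (Fin n) (Fin n) 𝕜} (hb : b.BlockTriangular id)
    (hbdet : IsUnit b.det) {X : Matrix (Fin n) (Fin n) 𝕜} (hX : X ∈ upperNilpLie 𝕜 n) :
    b * X * b⁻¹ ∈ upperNilpLie 𝕜 n := by
  haveI := b.invertibleOfIsUnitDet hbdet
  have hbinv : b⁻¹.BlockTriangular id := Matrix.blockTriangular_inv_of_blockTriangular hb
  rw [mem_upperNilpLie_iff] at hX ⊢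
  intro i j hji
  rw [Matrix.mul_apply]
  refine Finset.sum_eq_zero fun l _ => ?_
  rw [Matrix.mul_apply, Finset.sum_mul]
  refine Finset.sum_eq_zero fun k _ => ?_
  by_cases h1 : k < i
  · rw [hb h1, zero_mul, zero_mul]
  by_cases h2 : l ≤ k
  · rw [hX k l h2, mul_zero, zero_mul]
  by_cases h3 : j < l
  · rw [hbinv h3, mul_zero]
  exfalso
  exact lt_irrefl i (lt_of_lt_of_le (lt_of_le_of_lt (not_lt.mp h1) (not_le.mp h2))
    ((not_lt.mp h3).trans hji))

/-- For `b` upper triangular invertible, `b · diag(h) · b⁻¹ - diag(h)` is strictly upper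
triangular (`Ad(b)` acts trivially on `𝔥` modulo `𝔫`). [folklore] -/
theorem conj_diagonal_sub_mem_upperNilpLie {b : Matrix (Fin n) (Fin n) 𝕜} (hb : b.BlockTriangular id)
    (hbdet : IsUnit b.det) (h : Fin n → 𝕜) :
    b * Matrix.diagonal h * b⁻¹ - Matrix.diagonal h ∈ upperNilpLie 𝕜 n := by
  haveI := b.invertibleOfIsUnitDet hbdet
  have hbinv : b⁻¹.BlockTriangular id := Matrix.blockTriangular_inv_of_blockTriangular hb
  rw [mem_upperNilpLie_iff]
  intro i j hji
  rw [Matrix.sub_apply, Matrix.mul_apply]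
  simp_rw [Matrix.mul_diagonal]
  rcases hji.lt_or_eq with hlt | heq
  · -- below the diagonal both terms vanish
    rw [Matrix.diagonal_apply_ne _ (ne_of_gt hlt), sub_zero]
    refine Finset.sum_eq_zero fun k _ => ?_
    by_cases h1 : k < i
    · rw [hb h1, zero_mul, zero_mul]
    · rw [hbinv (lt_of_lt_of_le hlt (not_lt.mp h1)), mul_zero]
  · -- on the diagonal: `∑_k b_ik h_k (b⁻¹)_ki = b_ii h_i (b⁻¹)_ii = h_i`
    subst heq
    rw [Matrix.diagonal_apply_eq, Finset.sum_eq_single j, sub_eq_zero]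
    · have hone : b j j * b⁻¹ j j = 1 := by
        have e := congrFun (congrFun (Matrix.mul_nonsing_inv b hbdet) j) j
        rw [Matrix.mul_apply, Finset.sum_eq_single j, Matrix.one_apply_eq] at e
        · exact e
        · intro k _ hk
          rcases hk.lt_or_gt with hlt | hgt
          · rw [hb hlt, zero_mul]
          · rw [hbinv hgt, mul_zero]
        · exact fun hi => absurd (Finset.mem_univ j) hi
      rw [mul_right_comm, hone, one_mul]
    · intro k _ hk
      rcases hk.lt_or_gt with hlt | hgt
      · rw [hb hlt, zero_mul, zero_mul]
      · rw [hbinv hgt, mul_zero]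
    · exact fun hi => absurd (Finset.mem_univ j) hi

variable {V : Type*} [AddCommGroup V] [Module ℂ V]

/-- **Inner automorphisms by upper triangular matrices preserve highest weight vectors** (and
their weights): `Ad(b)` preserves `𝔫` and `Ad(b)(diag h) ≡ diag h mod 𝔫`. Knapp 2002, §V.2.
[folklore] -/
theorem IsHighestWeightVector.comp_conj_upper {ρ𝔤 : Matrix (Fin n) (Fin n) 𝕜 →ₗ⁅ℝ⁆ Module.End ℂ V}
    {l : ArchWeightGL 𝕜 n} {v : V} (hv : IsHighestWeightVector ρ𝔤 l v) {b : Matrix (Fin n) (Fin n) 𝕜}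
    (hb : b.BlockTriangular id) (hbdet : IsUnit b.det)
    (e : Matrix (Fin n) (Fin n) 𝕜 →ₗ⁅ℝ⁆ Matrix (Fin n) (Fin n) 𝕜) (he : ∀ X, e X = b * X * b⁻¹) :
    IsHighestWeightVector (ρ𝔤.comp e) l v := by
  refine ⟨hv.1, fun X hX => ?_, fun h => ?_⟩
  · rw [LieHom.comp_apply, he]
    exact hv.2.1 _ (conj_mem_upperNilpLie hb hbdet hX)
  · rw [LieHom.comp_apply, he]
    have hsplit : b * Matrix.diagonal h * b⁻¹ =
        (b * Matrix.diagonal h * b⁻¹ - Matrix.diagonal h) + Matrix.diagonal h := by abel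
    rw [hsplit, map_add, LinearMap.add_apply, hv.2.2 h,
      hv.2.1 _ (conj_diagonal_sub_mem_upperNilpLie hb hbdet h), zero_add]

/-! ### Injectivity of the Harish-Chandra homomorphism on `Z(𝔤)` -/

/-- The Harish-Chandra homomorphism is injective on `Z(𝔤)` (its complexification is injective,
`HarishChandraHomGL.baseChange_injective_and_range_eq`, and `z ↦ 1 ⊗ z` is injective: `re ⊗ id`
retracts it). Knapp 2002, Thm. 5.44. [cite: Knapp2002, §V.5 Thm. 5.44] -/
theorem HarishChandraHomGL.toAlgHom_injective (γ : HarishChandraHomGL 𝕜 n) :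
    Function.Injective γ.toAlgHom := by
  intro z₁ z₂ h
  have h1 : γ.baseChange ((1 : ℂ) ⊗ₜ z₁) = γ.baseChange ((1 : ℂ) ⊗ₜ z₂) := by
    rw [HarishChandraHomGL.baseChange_tmul, HarishChandraHomGL.baseChange_tmul, h]
  have h2 := γ.baseChange_injective_and_range_eq.1 h1
  -- the retraction `c ⊗ z ↦ re(c) • z`
  let r : ℂ ⊗[ℝ] Subalgebra.center ℝ (UniversalEnvelopingAlgebra ℝ (Matrix (Fin n) (Fin n) 𝕜)) →ₗ[ℝ]
      Subalgebra.center ℝ (UniversalEnvelopingAlgebra ℝ (Matrix (Fin n) (Fin n) 𝕜)) :=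
    TensorProduct.lift ((LinearMap.lsmul ℝ _).comp Complex.reLm)
  have hr : ∀ z, r ((1 : ℂ) ⊗ₜ z) = z := fun z => by
    simp [r, TensorProduct.lift.tmul]
  rw [← hr z₁, ← hr z₂, h2]

/-! ### The adjoint group fixes the centre -/

/-- **`U(Ad b) z = z` for `b` upper triangular invertible and `z ∈ Z(𝔤)`**: both `z` and
`U(Ad b) z ∈ Z(𝔤)` act on the highest weight vector `f_c` of the polynomial model by
`γ(·)(λ_c + ρ)` (`HarishChandraHomGL.highestWeight`, for the representations `ρ` and `ρ ∘ Ad b`,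
which share `f_c` by `IsHighestWeightVector.comp_conj_upper`), and `U(Ad b) z` acts through
`ρ ∘ Ad b` as `z`; so `γ(U(Ad b) z) - γ(z)` vanishes at all `λ_c + ρ`, hence is `0`
(`eq_zero_of_forall_aeval_hwWeight`), and `γ` is injective. [cite: Knapp2002, §V.5 Thm. 5.44] -/
theorem lift_ι_comp_conj_eq_of_upper {b : Matrix (Fin n) (Fin n) 𝕜} (hb : b.BlockTriangular id)
    (hbdet : IsUnit b.det) (e : Matrix (Fin n) (Fin n) 𝕜 →ₗ⁅ℝ⁆ Matrix (Fin n) (Fin n) 𝕜)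
    (he : ∀ X, e X = b * X * b⁻¹) (hebij : Function.Bijective e)
    {z : UniversalEnvelopingAlgebra ℝ (Matrix (Fin n) (Fin n) 𝕜)}
    (hz : z ∈ Subalgebra.center ℝ (UniversalEnvelopingAlgebra ℝ (Matrix (Fin n) (Fin n) 𝕜))) :
    UniversalEnvelopingAlgebra.lift ℝ ((UniversalEnvelopingAlgebra.ι ℝ).comp e) z = z := by
  classical
  set γ : HarishChandraHomGL 𝕜 n := harishChandraHomGL 𝕜 n
  have hz' : UniversalEnvelopingAlgebra.lift ℝ ((UniversalEnvelopingAlgebra.ι ℝ).comp e) z ∈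
      Subalgebra.center ℝ (UniversalEnvelopingAlgebra ℝ (Matrix (Fin n) (Fin n) 𝕜)) :=
    lift_ι_comp_mem_center (LieEquiv.ofBijective e hebij) hz
  suffices hγ : γ.toAlgHom ⟨_, hz'⟩ = γ.toAlgHom ⟨z, hz⟩ from
    congrArg Subtype.val (γ.toAlgHom_injective hγ)
  set m := Fintype.card (𝕜 →ₐ[ℝ] ℂ)
  let en : (𝕜 →ₐ[ℝ] ℂ) ≃ Fin m := Fintype.equivFin _
  rw [← sub_eq_zero, ← map_sub]
  have key : γ.toAlgHom (⟨_, hz'⟩ - ⟨z, hz⟩) = γ.toAlgHom ⟨_, hz'⟩ - γ.toAlgHom ⟨z, hz⟩ := map_sub _ _ _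
  rw [key]
  refine eq_zero_of_forall_aeval_hwWeight n 𝕜 m en _ fun c => ?_
  have hv := isHighestWeightVector_hwPoly n en c
  have hv' := hv.comp_conj_upper hb hbdet e he
  have k₁ := γ.highestWeight _ (blockPolyRep 𝕜 n m en.symm) (hwWeight n en c) (hwPoly n m c) hv ⟨_, hz'⟩
  have k₂ := γ.highestWeight _ ((blockPolyRep 𝕜 n m en.symm).comp e) (hwWeight n en c)
    (hwPoly n m c) hv' ⟨z, hz⟩
  rw [UniversalEnvelopingAlgebra.lift_comp_apply] at k₂
  change UniversalEnvelopingAlgebra.lift ℝ (blockPolyRep 𝕜 n m en.symm)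
      (UniversalEnvelopingAlgebra.lift ℝ ((UniversalEnvelopingAlgebra.ι ℝ).comp e) z)
      (hwPoly n m c) = _ at k₁
  rw [k₁] at k₂
  rw [map_sub, sub_eq_zero]
  exact smul_left_injective ℂ hv.1 k₂

/-- **`U(Ad L) z = z` for `L` lower triangular invertible** (`Lᵀ` upper triangular): with the
automorphism `θ(X) = -Xᵀ` of `𝔤𝔩ₙ(𝕜)` and `b = (Lᵀ)⁻¹` (upper triangular),
`Ad L = θ ∘ Ad b ∘ θ⁻¹`, and `U(θ⁻¹) z ∈ Z(𝔤)` is fixed by `U(Ad b)`. [folklore] -/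
theorem lift_ι_comp_conj_eq_of_lower {L : Matrix (Fin n) (Fin n) 𝕜} (hL : Lᵀ.BlockTriangular id)
    (hLdet : IsUnit L.det) (e : Matrix (Fin n) (Fin n) 𝕜 →ₗ⁅ℝ⁆ Matrix (Fin n) (Fin n) 𝕜)
    (he : ∀ X, e X = L * X * L⁻¹)
    {z : UniversalEnvelopingAlgebra ℝ (Matrix (Fin n) (Fin n) 𝕜)}
    (hz : z ∈ Subalgebra.center ℝ (UniversalEnvelopingAlgebra ℝ (Matrix (Fin n) (Fin n) 𝕜))) :
    UniversalEnvelopingAlgebra.lift ℝ ((UniversalEnvelopingAlgebra.ι ℝ).comp e) z = z := by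
  -- the automorphism `θ X = -Xᵀ`
  let θ : Matrix (Fin n) (Fin n) 𝕜 ≃ₗ⁅ℝ⁆ Matrix (Fin n) (Fin n) 𝕜 :=
    { toFun := fun X => -Xᵀ
      invFun := fun X => -Xᵀ
      map_add' := fun X Y => by rw [Matrix.transpose_add, neg_add]
      map_smul' := fun c X => by rw [Matrix.transpose_smul, smul_neg, RingHom.id_apply]
      map_lie' := fun {X Y} => by
        simp only [LieRing.of_associative_ring_bracket, Matrix.transpose_sub, Matrix.transpose_mul,
          Matrix.neg_mul, Matrix.mul_neg, neg_neg]
        abel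
      left_inv := fun X => by simp
      right_inv := fun X => by simp }
  have hθ : ∀ X, θ X = -Xᵀ := fun X => rfl
  have hθs : ∀ X, θ.symm X = -Xᵀ := fun X => rfl
  -- `b = (Lᵀ)⁻¹`, upper triangular invertible
  have hLTdet : IsUnit Lᵀ.det := Matrix.isUnit_det_transpose L hLdet
  haveI := Lᵀ.invertibleOfIsUnitDet hLTdet
  have hb : (Lᵀ)⁻¹.BlockTriangular id := Matrix.blockTriangular_inv_of_blockTriangular hL
  have hbdet : IsUnit (Lᵀ)⁻¹.det := Matrix.isUnit_nonsing_inv_det _ hLTdet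
  obtain ⟨eb, heb, hebbij⟩ := exists_lieHom_conj (Lᵀ)⁻¹ hbdet
  -- `Ad L = θ ∘ Ad b ∘ θ⁻¹`
  have hcomp : e = θ.toLieHom.comp (eb.comp θ.symm.toLieHom) := by
    refine LieHom.ext fun X => ?_
    rw [LieHom.comp_apply, LieHom.comp_apply, he]
    change L * X * L⁻¹ = θ (eb (θ.symm X))
    rw [hθs, heb, hθ, Matrix.nonsing_inv_nonsing_inv _ hLTdet, Matrix.mul_neg, Matrix.neg_mul,
      Matrix.transpose_neg, neg_neg, Matrix.transpose_mul, Matrix.transpose_mul,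
      Matrix.transpose_transpose, Matrix.transpose_transpose, Matrix.transpose_nonsing_inv,
      Matrix.transpose_transpose, Matrix.mul_assoc]
  rw [hcomp, lift_ι_comp_comp, lift_ι_comp_comp,
    lift_ι_comp_conj_eq_of_upper hb hbdet eb heb hebbij (lift_ι_comp_mem_center θ.symm hz),
    ← lift_ι_comp_comp,
    show θ.toLieHom.comp θ.symm.toLieHom = LieHom.id from LieHom.ext fun X => θ.apply_symm_apply X,
    lift_ι_comp_id]

/-- **The adjoint group acts trivially on the centre of `U(𝔤𝔩ₙ(𝕜))`**: for every invertible
`M` and every real Lie algebra map `e` with `e X = M X M⁻¹` (i.e. `e = Ad M`, cf.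
`exists_lieHom_conj`), `U(e) z = z` for all `z ∈ Z(𝔤)`. Proof: `GL_n(𝕜)` is generated by
invertible diagonal matrices and transvections (Mathlib
`Matrix.diagonal_transvection_induction_of_det_ne_zero`), which are upper or lower triangular
(`lift_ι_comp_conj_eq_of_upper`, `lift_ι_comp_conj_eq_of_lower`), and `Ad(AB) = Ad A ∘ Ad B`.
Dixmier, *Enveloping Algebras*, 2.4.17 (connected case); Knapp–Vogan 1995, remark after
Prop. 4.117. [cite: KnappVogan1995, §IV.8, Prop. 4.117] -/
theorem lift_ι_comp_conj_eq {M : Matrix (Fin n) (Fin n) 𝕜} (hM : IsUnit M.det)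
    (e : Matrix (Fin n) (Fin n) 𝕜 →ₗ⁅ℝ⁆ Matrix (Fin n) (Fin n) 𝕜) (he : ∀ X, e X = M * X * M⁻¹)
    {z : UniversalEnvelopingAlgebra ℝ (Matrix (Fin n) (Fin n) 𝕜)}
    (hz : z ∈ Subalgebra.center ℝ (UniversalEnvelopingAlgebra ℝ (Matrix (Fin n) (Fin n) 𝕜))) :
    UniversalEnvelopingAlgebra.lift ℝ ((UniversalEnvelopingAlgebra.ι ℝ).comp e) z = z := by
  classical
  have main : ∀ A : Matrix (Fin n) (Fin n) 𝕜, A.det ≠ 0 →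
      ∀ e : Matrix (Fin n) (Fin n) 𝕜 →ₗ⁅ℝ⁆ Matrix (Fin n) (Fin n) 𝕜, (∀ X, e X = A * X * A⁻¹) →
        ∀ z ∈ Subalgebra.center ℝ (UniversalEnvelopingAlgebra ℝ (Matrix (Fin n) (Fin n) 𝕜)),
          UniversalEnvelopingAlgebra.lift ℝ ((UniversalEnvelopingAlgebra.ι ℝ).comp e) z = z := by
    intro A hA
    refine Matrix.diagonal_transvection_induction_of_det_ne_zero
      (fun A : Matrix (Fin n) (Fin n) 𝕜 =>
        ∀ e : Matrix (Fin n) (Fin n) 𝕜 →ₗ⁅ℝ⁆ Matrix (Fin n) (Fin n) 𝕜, (∀ X, e X = A * X * A⁻¹) →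
          ∀ z ∈ Subalgebra.center ℝ (UniversalEnvelopingAlgebra ℝ (Matrix (Fin n) (Fin n) 𝕜)),
            UniversalEnvelopingAlgebra.lift ℝ ((UniversalEnvelopingAlgebra.ι ℝ).comp e) z = z)
      A hA ?_ ?_ ?_
    · -- invertible diagonal matrices are upper triangular
      intro D hD e he z hz
      have hDu : IsUnit (Matrix.diagonal D).det := isUnit_iff_ne_zero.mpr hD
      obtain ⟨e', he', hbij'⟩ := exists_lieHom_conj (Matrix.diagonal D) hDu
      have hee : e = e' := LieHom.ext fun X => by rw [he, he']
      rw [hee]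
      exact lift_ι_comp_conj_eq_of_upper (Matrix.blockTriangular_diagonal D) hDu e' he' hbij' hz
    · -- transvections are upper or lower triangular
      intro t e he z hz
      have hdet : IsUnit t.toMatrix.det := by
        rw [Matrix.TransvectionStruct.det]
        exact isUnit_one
      rcases lt_or_gt_of_ne t.hij with h | h
      · obtain ⟨e', he', hbij'⟩ := exists_lieHom_conj t.toMatrix hdet
        have hee : e = e' := LieHom.ext fun X => by rw [he, he']
        rw [hee]
        refine lift_ι_comp_conj_eq_of_upper ?_ hdet e' he' hbij' hz
        rw [Matrix.TransvectionStruct.toMatrix]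
        exact Matrix.blockTriangular_transvection h.le t.c
      · refine lift_ι_comp_conj_eq_of_lower ?_ hdet e he hz
        rw [Matrix.TransvectionStruct.toMatrix, Matrix.transvection, Matrix.transpose_add,
          Matrix.transpose_one, Matrix.transpose_single, ← Matrix.transvection]
        exact Matrix.blockTriangular_transvection h.le t.c
    · -- `Ad (A B) = Ad A ∘ Ad B`
      intro A B hA hB hPA hPB e he z hz
      obtain ⟨eA, heA, -⟩ := exists_lieHom_conj A (isUnit_iff_ne_zero.mpr hA)
      obtain ⟨eB, heB, hBbij⟩ := exists_lieHom_conj B (isUnit_iff_ne_zero.mpr hB)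
      have hcomp : e = eA.comp eB := LieHom.ext fun X => by
        rw [LieHom.comp_apply, he, heA, heB, Matrix.mul_inv_rev]
        simp only [Matrix.mul_assoc]
      have hmem : UniversalEnvelopingAlgebra.lift ℝ ((UniversalEnvelopingAlgebra.ι ℝ).comp eB) z ∈
          Subalgebra.center ℝ (UniversalEnvelopingAlgebra ℝ (Matrix (Fin n) (Fin n) 𝕜)) :=
        lift_ι_comp_mem_center (LieEquiv.ofBijective eB hBbij) hz
      rw [hcomp, lift_ι_comp_comp, hPA eA heA _ hmem, hPB eB heB z hz]
  exact main M (isUnit_iff_ne_zero.mp hM) e he z hz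

/-- **Twisting a representation by an inner automorphism does not change the action of the
centre**: for `ρ : 𝔤𝔩ₙ(𝕜) → End V`, `M` invertible, `e = Ad M` and `z ∈ Z(𝔤)`,
`lift (ρ ∘ e) z = lift ρ z` (as `lift (ρ ∘ e) z = lift ρ (U(e) z)` and `U(e) z = z`). This is the
form in which the result enters Schur's lemma for `(𝔤, K)`-modules with disconnected `K`
(`Ad(k) z = z`; Knapp–Vogan 1995, remark after Prop. 4.117). [cite: KnappVogan1995, §IV.8, Prop. 4.117] -/
theorem lift_comp_conj_eq_lift (ρ𝔤 : Matrix (Fin n) (Fin n) 𝕜 →ₗ⁅ℝ⁆ Module.End ℂ V)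
    {M : Matrix (Fin n) (Fin n) 𝕜} (hM : IsUnit M.det)
    (e : Matrix (Fin n) (Fin n) 𝕜 →ₗ⁅ℝ⁆ Matrix (Fin n) (Fin n) 𝕜) (he : ∀ X, e X = M * X * M⁻¹)
    {z : UniversalEnvelopingAlgebra ℝ (Matrix (Fin n) (Fin n) 𝕜)}
    (hz : z ∈ Subalgebra.center ℝ (UniversalEnvelopingAlgebra ℝ (Matrix (Fin n) (Fin n) 𝕜))) :
    UniversalEnvelopingAlgebra.lift ℝ (ρ𝔤.comp e) z = UniversalEnvelopingAlgebra.lift ℝ ρ𝔤 z := by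
  rw [UniversalEnvelopingAlgebra.lift_comp_apply, lift_ι_comp_conj_eq hM e he hz]

end GLn

end Literature.NumberTheory.Automorphic
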